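import Summits.KontsevichZagierPeriods.KontsevichZagierPeriods.Theorems.HurwitzMicroSectorsNormalFormPrincipleDilogExistsBoxAtoms

/-!
# `NormalFormPrinciple` (stmt-KontsevichZagierPeriods-3869), line `SketchIdeator1` —
# leaf `stub_boxRigidity`, layer M3 (Tornheim weight drop): the wedge chart of the unit cube

Pure proof file (stub `wdt_box_sub_wedge` of the layer `M3`, lead seat c9; `--supports` the crux).
The Tornheim weight drop `[(0,1)³, 1/((1 − xy)(1 − xz))] ∼ [(0,1)², 2/(1 − xy)]`
(`Σ 1/(mn(m+n−1)) = 2ζ(2)`) is proved by the lead as a move chain of the Kontsevich–Zagier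
calculus whose first link is supplied here: ONE change-of-variables move (rule (2)) along the
*wedge chart* of the open unit cube `□³ = (0,1)³`,

  `Ψ(x₀, x₁, x₂) = (x₀, x₀x₁, x₀x₂)`, `DΨ(x) = !![1, 0, 0; x₁, x₀, 0; x₂, 0, x₀]`, `det DΨ = x₀²`,

a `ℚ`-polynomial (hence `ℚ`-semialgebraic) map, injective on `□³` (`x₁ = t₁/t₀`, `x₂ = t₂/t₀`)
with image the open wedge `V = {0 < t₁ < t₀, 0 < t₂ < t₀, t₀ < 1}`. The pull-back identity
`1/(t₀²(1 − t₁)(1 − t₂)) ∘ Ψ · x₀² = 1/((1 − x₀x₁)(1 − x₀x₂))` holds on `□³`, so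
`[□³, 1/((1 − x₀x₁)(1 − x₀x₂))] − [V, 1/(t₀²(1 − t₁)(1 − t₂))] ∈ KZ.changeOfVariablesRel`
(part (1)); and the wedge representation EXISTS (part (2)): `V` is cut out by strict
`ℚ`-polynomial inequalities, the integrand is a quotient of `ℚ`-polynomials with non-vanishing
denominator on `V`, and absolute convergence on `V = Ψ '' □³` is transported from the cube along
`Ψ` by Mathlib's Jacobian criterion
`MeasureTheory.integrableOn_image_iff_integrableOn_abs_det_fderiv_smul`.

References: M. Kontsevich, D. Zagier, *Periods* (2001), §1.1–1.2 (rule (2)). No definitions are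
introduced.
-/

noncomputable section

open MeasureTheory Set
open Literature.NumberTheory.Transcendental Literature.NumberTheory.Transcendental.KZ
open Literature.ModelTheory.ExponentialFields (IsSemialgebraic)

namespace Summit.KontsevichZagierPeriods.HurwitzMicroSectors.NormalFormPrinciple.PiBox.M3

/-! ## Elementary facts on the open unit cube -/

/-- On the open unit cube, `0 < 1 − x₀ xᵢ`. [folklore] -/
theorem wdt1_one_sub_mul_pos {x : Fin 3 → ℝ} (hx : ∀ i, x i ∈ Set.Ioo (0:ℝ) 1) (i : Fin 3) :
    0 < 1 - x 0 * x i :=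
  sub_pos.2 (mul_lt_one_of_nonneg_of_lt_one_left (hx 0).1.le (hx 0).2 (hx i).2.le)

/-- **The pull-back identity** of the wedge chart (Jacobian `a²` included):
`1/((1 − ab)(1 − ac)) = 1/(a²(1 − ab)(1 − ac)) · a²` whenever `a ≠ 0` and the two factors
`1 − ab`, `1 − ac` are non-zero. [folklore] -/
theorem wdt1_pullback {a b c : ℝ} (ha : a ≠ 0) (hb : 1 - a * b ≠ 0) (hc : 1 - a * c ≠ 0) :
    1 / ((1 - a * b) * (1 - a * c)) = 1 / (a ^ 2 * (1 - a * b) * (1 - a * c)) * a ^ 2 := by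
  have hD : (1 - a * b) * (1 - a * c) ≠ 0 := mul_ne_zero hb hc
  have hE : a ^ 2 * (1 - a * b) * (1 - a * c) ≠ 0 :=
    mul_ne_zero (mul_ne_zero (pow_ne_zero 2 ha) hb) hc
  rw [div_mul_eq_mul_div, one_mul, div_eq_div_iff hD hE]
  ring

/-! ## The wedge chart -/

/-- **The wedge chart `Ψ(x₀,x₁,x₂) = (x₀, x₀x₁, x₀x₂)`** of the open unit cube: a `ℚ`-polynomial
(hence `ℚ`-semialgebraic) map, differentiable with derivative `!![1, 0, 0; x₁, x₀, 0; x₂, 0, x₀]`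
and `|det DΨ| = x₀²` on the cube, injective on the cube (`x₀ ≠ 0` there) and ONTO the open wedge
`{0 < t₁ < t₀, 0 < t₂ < t₀, t₀ < 1}` (inverse `t ↦ (t₀, t₁/t₀, t₂/t₀)`). [folklore] -/
theorem wdt1_exists_wedgeChart :
    ∃ (Ψ : (Fin 3 → ℝ) → (Fin 3 → ℝ)) (Ψ' : (Fin 3 → ℝ) → (Fin 3 → ℝ) →L[ℝ] (Fin 3 → ℝ)),
      (∀ x, Ψ x 0 = x 0) ∧ (∀ x, Ψ x 1 = x 0 * x 1) ∧ (∀ x, Ψ x 2 = x 0 * x 2) ∧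
      IsSemialgebraicMapOn ℚ {x : Fin 3 → ℝ | ∀ i, x i ∈ Set.Ioo (0:ℝ) 1} Ψ ∧
      (∀ x, HasFDerivAt Ψ (Ψ' x) x) ∧
      Set.InjOn Ψ {x : Fin 3 → ℝ | ∀ i, x i ∈ Set.Ioo (0:ℝ) 1} ∧
      Ψ '' {x : Fin 3 → ℝ | ∀ i, x i ∈ Set.Ioo (0:ℝ) 1} =
        {t | 0 < t 1 ∧ t 1 < t 0 ∧ 0 < t 2 ∧ t 2 < t 0 ∧ t 0 < 1} ∧
      (∀ x ∈ {x : Fin 3 → ℝ | ∀ i, x i ∈ Set.Ioo (0:ℝ) 1}, |(Ψ' x).det| = x 0 ^ 2) := by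
  set Ψ : (Fin 3 → ℝ) → (Fin 3 → ℝ) := fun x => ![x 0, x 0 * x 1, x 0 * x 2]
  set Ψ' : (Fin 3 → ℝ) → (Fin 3 → ℝ) →L[ℝ] (Fin 3 → ℝ) := fun x =>
    LinearMap.toContinuousLinearMap (Matrix.toLin' !![1, 0, 0; x 1, x 0, 0; x 2, 0, x 0])
  have hΨ0 : ∀ x, Ψ x 0 = x 0 := fun x => rfl
  have hΨ1 : ∀ x, Ψ x 1 = x 0 * x 1 := fun x => rfl
  have hΨ2 : ∀ x, Ψ x 2 = x 0 * x 2 := fun x => rfl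
  have hΨ'0 : ∀ x v : Fin 3 → ℝ, Ψ' x v 0 = v 0 := by
    intro x v
    change Matrix.toLin' !![1, 0, 0; x 1, x 0, 0; x 2, 0, x 0] v 0 = _
    rw [Matrix.toLin'_apply]
    simp [Matrix.mulVec, dotProduct, Fin.sum_univ_three]
  have hΨ'1 : ∀ x v : Fin 3 → ℝ, Ψ' x v 1 = x 1 * v 0 + x 0 * v 1 := by
    intro x v
    change Matrix.toLin' !![1, 0, 0; x 1, x 0, 0; x 2, 0, x 0] v 1 = _
    rw [Matrix.toLin'_apply]
    simp [Matrix.mulVec, dotProduct, Fin.sum_univ_three]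
  have hΨ'2 : ∀ x v : Fin 3 → ℝ, Ψ' x v 2 = x 2 * v 0 + x 0 * v 2 := by
    intro x v
    change Matrix.toLin' !![1, 0, 0; x 1, x 0, 0; x 2, 0, x 0] v 2 = _
    rw [Matrix.toLin'_apply]
    simp [Matrix.mulVec, dotProduct, Fin.sum_univ_three]
  have hdet : ∀ x, (Ψ' x).det = x 0 ^ 2 := by
    intro x
    change LinearMap.det (Matrix.toLin' !![1, 0, 0; x 1, x 0, 0; x 2, 0, x 0]) = _
    rw [LinearMap.det_toLin', Matrix.det_fin_three]
    simp only [Matrix.of_apply, Matrix.cons_val', Matrix.cons_val_zero, Matrix.cons_val_one,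
      Matrix.cons_val_two, Matrix.cons_val_fin_one, Matrix.head_cons, Matrix.tail_cons,
      Matrix.empty_val', Matrix.head_fin_const]
    ring
  have hderiv : ∀ x, HasFDerivAt Ψ (Ψ' x) x := by
    intro x
    have h0 : HasFDerivAt (fun y : Fin 3 → ℝ => y 0)
        (ContinuousLinearMap.proj (R := ℝ) (φ := fun _ : Fin 3 => ℝ) 0) x := hasFDerivAt_apply 0 x
    have h1 : HasFDerivAt (fun y : Fin 3 → ℝ => y 1)
        (ContinuousLinearMap.proj (R := ℝ) (φ := fun _ : Fin 3 => ℝ) 1) x := hasFDerivAt_apply 1 x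
    have h2 : HasFDerivAt (fun y : Fin 3 → ℝ => y 2)
        (ContinuousLinearMap.proj (R := ℝ) (φ := fun _ : Fin 3 => ℝ) 2) x := hasFDerivAt_apply 2 x
    have c0 : HasFDerivAt (fun y : Fin 3 → ℝ => Ψ y 0)
        ((ContinuousLinearMap.proj 0).comp (Ψ' x)) x := by
      have hf : (fun y : Fin 3 → ℝ => Ψ y 0) = fun y => y 0 := funext fun y => hΨ0 y
      rw [hf]
      refine h0.congr_fderiv (ContinuousLinearMap.ext fun v => ?_)
      simp [hΨ'0]
    have c1 : HasFDerivAt (fun y : Fin 3 → ℝ => Ψ y 1)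
        ((ContinuousLinearMap.proj 1).comp (Ψ' x)) x := by
      have hf : (fun y : Fin 3 → ℝ => Ψ y 1) = fun y => y 0 * y 1 := funext fun y => hΨ1 y
      rw [hf]
      refine (h0.mul h1).congr_fderiv (ContinuousLinearMap.ext fun v => ?_)
      simp [hΨ'1]
      ring
    have c2 : HasFDerivAt (fun y : Fin 3 → ℝ => Ψ y 2)
        ((ContinuousLinearMap.proj 2).comp (Ψ' x)) x := by
      have hf : (fun y : Fin 3 → ℝ => Ψ y 2) = fun y => y 0 * y 2 := funext fun y => hΨ2 y
      rw [hf]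
      refine (h0.mul h2).congr_fderiv (ContinuousLinearMap.ext fun v => ?_)
      simp [hΨ'2]
      ring
    rw [hasFDerivAt_pi']
    intro i
    fin_cases i
    · exact c0
    · exact c1
    · exact c2
  refine ⟨Ψ, Ψ', hΨ0, hΨ1, hΨ2, ?_, hderiv, ?_, ?_, fun x hx => ?_⟩
  · -- a `ℚ`-polynomial map is `ℚ`-semialgebraic
    convert isSemialgebraicMapOn_aeval (isSemialgebraic_box 3)
      ![MvPolynomial.X 0, MvPolynomial.X 0 * MvPolynomial.X 1,
        (MvPolynomial.X 0 * MvPolynomial.X 2 : MvPolynomial (Fin 3) ℚ)] using 2 with x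
    funext i
    fin_cases i
    · simp [hΨ0]
    · simp [hΨ1]
    · simp [hΨ2]
  · -- injective on the cube (`x₀ ≠ 0` there)
    intro x hx y hy hxy
    have e0 : x 0 = y 0 := (hΨ0 x).symm.trans ((congrFun hxy 0).trans (hΨ0 y))
    have e1 : x 0 * x 1 = y 0 * y 1 := (hΨ1 x).symm.trans ((congrFun hxy 1).trans (hΨ1 y))
    have e2 : x 0 * x 2 = y 0 * y 2 := (hΨ2 x).symm.trans ((congrFun hxy 2).trans (hΨ2 y))
    rw [e0] at e1 e2
    have hy0 : y 0 ≠ 0 := (hy 0).1.ne'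
    have f1 : x 1 = y 1 := mul_left_cancel₀ hy0 e1
    have f2 : x 2 = y 2 := mul_left_cancel₀ hy0 e2
    funext i
    fin_cases i
    · exact e0
    · exact f1
    · exact f2
  · -- onto the wedge
    ext t
    constructor
    · rintro ⟨x, hx, rfl⟩
      rw [mem_setOf_eq, hΨ0, hΨ1, hΨ2]
      exact ⟨mul_pos (hx 0).1 (hx 1).1, mul_lt_of_lt_one_right (hx 0).1 (hx 1).2,
        mul_pos (hx 0).1 (hx 2).1, mul_lt_of_lt_one_right (hx 0).1 (hx 2).2, (hx 0).2⟩
    · rintro ⟨h1, h10, h2, h20, h01⟩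
      have ht0 : 0 < t 0 := h1.trans h10
      refine ⟨![t 0, t 1 / t 0, t 2 / t 0], ?_, ?_⟩
      · intro i
        fin_cases i
        · exact ⟨ht0, h01⟩
        · exact ⟨div_pos h1 ht0, (div_lt_one ht0).2 h10⟩
        · exact ⟨div_pos h2 ht0, (div_lt_one ht0).2 h20⟩
      · funext i
        fin_cases i
        · rfl
        · change t 0 * (t 1 / t 0) = t 1
          exact mul_div_cancel₀ _ ht0.ne'
        · change t 0 * (t 2 / t 0) = t 2
          exact mul_div_cancel₀ _ ht0.ne'
  · -- the Jacobian
    rw [hdet, abs_of_pos (pow_pos (hx 0).1 2)]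

/-! ## The wedge representation: semialgebraicity -/

/-- **The open wedge `{0 < t₁ < t₀, 0 < t₂ < t₀, t₀ < 1}` is `ℚ`-semialgebraic**: an intersection
of five strict `ℚ`-polynomial inequalities. [cite: KontsevichZagier2001, §1.1] -/
theorem wdt1_isSemialgebraic_wedge :
    IsSemialgebraic ℚ {t : Fin 3 → ℝ | 0 < t 1 ∧ t 1 < t 0 ∧ 0 < t 2 ∧ t 2 < t 0 ∧ t 0 < 1} := by
  have h1 := Literature.ModelTheory.ExponentialFields.isSemialgebraic_setOf_eval_lt (k := ℚ)
    (R := ℝ) (0 : MvPolynomial (Fin 3) ℚ) (MvPolynomial.X 1)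
  have h2 := Literature.ModelTheory.ExponentialFields.isSemialgebraic_setOf_eval_lt (k := ℚ)
    (R := ℝ) (MvPolynomial.X 1 : MvPolynomial (Fin 3) ℚ) (MvPolynomial.X 0)
  have h3 := Literature.ModelTheory.ExponentialFields.isSemialgebraic_setOf_eval_lt (k := ℚ)
    (R := ℝ) (0 : MvPolynomial (Fin 3) ℚ) (MvPolynomial.X 2)
  have h4 := Literature.ModelTheory.ExponentialFields.isSemialgebraic_setOf_eval_lt (k := ℚ)
    (R := ℝ) (MvPolynomial.X 2 : MvPolynomial (Fin 3) ℚ) (MvPolynomial.X 0)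
  have h5 := Literature.ModelTheory.ExponentialFields.isSemialgebraic_setOf_eval_lt (k := ℚ)
    (R := ℝ) (MvPolynomial.X 0 : MvPolynomial (Fin 3) ℚ) 1
  simp only [MvPolynomial.aeval_X, map_zero, map_one] at h1 h2 h3 h4 h5
  have hV : {t : Fin 3 → ℝ | 0 < t 1 ∧ t 1 < t 0 ∧ 0 < t 2 ∧ t 2 < t 0 ∧ t 0 < 1} =
      {t : Fin 3 → ℝ | 0 < t 1} ∩ {t | t 1 < t 0} ∩ {t | 0 < t 2} ∩ {t | t 2 < t 0} ∩
        {t | t 0 < 1} := by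
    ext t
    simp only [mem_setOf_eq, mem_inter_iff, and_assoc]
  rw [hV]
  exact (((h1.inter h2).inter h3).inter h4).inter h5

/-- **Semialgebraicity of the wedge integrand `1/(t₀²(1 − t₁)(1 − t₂))`** on any `ℚ`-semialgebraic
set on which `t₀ ≠ 0`, `t₁ ≠ 1`, `t₂ ≠ 1`: a quotient of `ℚ`-polynomials with non-vanishing
denominator (`isSemialgebraicFunOn_aeval_div_aeval`). [cite: KontsevichZagier2001, §1.1] -/
theorem wdt1_isSemialgebraicFunOn_wedgeIntegrand {σ : Set (Fin 3 → ℝ)} (hσ : IsSemialgebraic ℚ σ)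
    (h0 : ∀ t ∈ σ, t 0 ≠ 0) (h1 : ∀ t ∈ σ, 1 - t 1 ≠ 0) (h2 : ∀ t ∈ σ, 1 - t 2 ≠ 0) :
    IsSemialgebraicFunOn ℚ σ (fun t => 1 / (t 0 ^ 2 * (1 - t 1) * (1 - t 2))) := by
  refine (isSemialgebraicFunOn_aeval_div_aeval hσ (1 : MvPolynomial (Fin 3) ℚ)
    (MvPolynomial.X 0 ^ 2 * (1 - MvPolynomial.X 1) * (1 - MvPolynomial.X 2))
    fun t ht => ?_).congr fun t _ => ?_
  · simp only [map_mul, map_sub, map_one, map_pow, MvPolynomial.aeval_X]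
    exact mul_ne_zero (mul_ne_zero (pow_ne_zero 2 (h0 t ht)) (h1 t ht)) (h2 t ht)
  · simp only [map_mul, map_sub, map_one, map_pow, MvPolynomial.aeval_X]

/-! ## The registered sub-goal -/

/-- **Stub T1 (the wedge chart `(x₀, x₀x₁, x₀x₂)`, rule (2), and existence of the wedge
representation; registered sub-goal `wdt_box_sub_wedge` of stmt-KontsevichZagierPeriods-3869,
line `SketchIdeator1`, layer M3).** (1) For representations `r` on the open unit cube with
integrand `1/((1 − x₀x₁)(1 − x₀x₂))` and `W` on the open wedge `{0 < t₁ < t₀, 0 < t₂ < t₀, t₀ < 1}`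
with integrand `1/(t₀²(1 − t₁)(1 − t₂))`, `[r] − [W]` is ONE change-of-variables move of the
Kontsevich–Zagier calculus along the wedge chart `Ψ(x) = (x₀, x₀x₁, x₀x₂)`
(`wdt1_exists_wedgeChart`; pull-back identity `wdt1_pullback`). (2) Given such an `r`, the wedge
representation `W` exists: its domain and integrand are `ℚ`-semialgebraic
(`wdt1_isSemialgebraic_wedge`, `wdt1_isSemialgebraicFunOn_wedgeIntegrand`) and absolute
convergence is transported from `r` along `Ψ`
(`MeasureTheory.integrableOn_image_iff_integrableOn_abs_det_fderiv_smul`).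
[cite: KontsevichZagier2001, §1.2 rule (2)] -/
theorem wdt_box_sub_wedge :
    (∀ (r W : IntegralRep 3),
      r.domain = {x | ∀ i, x i ∈ Set.Ioo (0:ℝ) 1} →
      EqOn r.integrand (fun x => 1 / ((1 - x 0 * x 1) * (1 - x 0 * x 2))) r.domain →
      W.domain = {t | 0 < t 1 ∧ t 1 < t 0 ∧ 0 < t 2 ∧ t 2 < t 0 ∧ t 0 < 1} →
      EqOn W.integrand (fun t => 1 / (t 0 ^ 2 * (1 - t 1) * (1 - t 2))) W.domain →
      of r - of W ∈ relations) ∧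
    (∀ (r : IntegralRep 3),
      r.domain = {x | ∀ i, x i ∈ Set.Ioo (0:ℝ) 1} →
      EqOn r.integrand (fun x => 1 / ((1 - x 0 * x 1) * (1 - x 0 * x 2))) r.domain →
      ∃ W : IntegralRep 3, W.domain = {t | 0 < t 1 ∧ t 1 < t 0 ∧ 0 < t 2 ∧ t 2 < t 0 ∧ t 0 < 1} ∧
        W.integrand = fun t => 1 / (t 0 ^ 2 * (1 - t 1) * (1 - t 2))) := by
  obtain ⟨Ψ, Ψ', hΨ0, hΨ1, hΨ2, hsa, hderiv, hinj, himage, hdet⟩ := wdt1_exists_wedgeChart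
  have hS : MeasurableSet {x : Fin 3 → ℝ | ∀ i, x i ∈ Set.Ioo (0:ℝ) 1} :=
    (isSemialgebraic_box 3).measurableSet_holds
  -- the pull-back identity on the cube, Jacobian `|det DΨ| = x₀²` included
  have hpull : ∀ x : Fin 3 → ℝ, (∀ i, x i ∈ Set.Ioo (0:ℝ) 1) →
      1 / ((1 - x 0 * x 1) * (1 - x 0 * x 2)) =
        1 / (Ψ x 0 ^ 2 * (1 - Ψ x 1) * (1 - Ψ x 2)) * |(Ψ' x).det| := by
    intro x hx
    rw [hΨ0, hΨ1, hΨ2, hdet x hx]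
    exact wdt1_pullback (hx 0).1.ne' (wdt1_one_sub_mul_pos hx 1).ne'
      (wdt1_one_sub_mul_pos hx 2).ne'
  refine ⟨fun r W hrd hri hWd hWi => ?_, fun r hrd hri => ?_⟩
  · -- part (1): ONE rule-(2) move along the wedge chart
    have himage' : W.domain = Ψ '' r.domain := by rw [hrd, himage, hWd]
    have hsa' : IsSemialgebraicMapOn ℚ r.domain Ψ := by rw [hrd]; exact hsa
    have hinj' : InjOn Ψ r.domain := by rw [hrd]; exact hinj
    refine changeOfVariablesRel_subset_relations
      ⟨3, r, W, Ψ, Ψ', hsa', fun x _ => (hderiv x).hasFDerivWithinAt, hinj', himage',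
        fun x hx => ?_, rfl⟩
    have hΨx : Ψ x ∈ W.domain := himage' ▸ mem_image_of_mem _ hx
    have hx' : ∀ i, x i ∈ Set.Ioo (0:ℝ) 1 := by rw [hrd] at hx; exact hx
    rw [hri hx, hWi hΨx]
    exact hpull x hx'
  · -- part (2): the wedge representation exists (integrability transported along `Ψ`)
    have hσ := wdt1_isSemialgebraic_wedge
    have hr : IntegrableOn r.integrand {x : Fin 3 → ℝ | ∀ i, x i ∈ Set.Ioo (0:ℝ) 1} :=
      hrd ▸ r.integrableOn
    have hri' : EqOn r.integrand (fun x => 1 / ((1 - x 0 * x 1) * (1 - x 0 * x 2)))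
        {x : Fin 3 → ℝ | ∀ i, x i ∈ Set.Ioo (0:ℝ) 1} := hrd ▸ hri
    have hint : IntegrableOn (fun t : Fin 3 → ℝ => 1 / (t 0 ^ 2 * (1 - t 1) * (1 - t 2)))
        {t | 0 < t 1 ∧ t 1 < t 0 ∧ 0 < t 2 ∧ t 2 < t 0 ∧ t 0 < 1} := by
      rw [← himage, integrableOn_image_iff_integrableOn_abs_det_fderiv_smul volume hS
        (fun x _ => (hderiv x).hasFDerivWithinAt) hinj]
      refine (hr.congr_fun hri' hS).congr_fun (fun x hx => ?_) hS
      show 1 / ((1 - x 0 * x 1) * (1 - x 0 * x 2)) =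
        |(Ψ' x).det| • (1 / (Ψ x 0 ^ 2 * (1 - Ψ x 1) * (1 - Ψ x 2)))
      rw [smul_eq_mul]
      exact (hpull x hx).trans (mul_comm _ _)
    exact ⟨⟨_, _, hσ, wdt1_isSemialgebraicFunOn_wedgeIntegrand hσ
      (fun _ ht => (ht.1.trans ht.2.1).ne') (fun _ ht => (sub_pos.2 (ht.2.1.trans ht.2.2.2.2)).ne')
      (fun _ ht => (sub_pos.2 (ht.2.2.2.1.trans ht.2.2.2.2)).ne'), hint⟩, rfl, rfl⟩

end Summit.KontsevichZagierPeriods.HurwitzMicroSectors.NormalFormPrinciple.PiBox.M3
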